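import Summits.CriticalPhenomena.CardyFormulaZ2.Theorems.CardyFlipRussoQuadrupoleSelectionRulePoissonLegTransfer
import Summits.CriticalPhenomena.CardyFormulaZ2.Theorems.CardyFlipRussoQuadrupoleSelectionRuleBitsReduction

/-!
# The kernel WITH A RATE on the Poisson superposition legs: point rate + point budget ⟹ leg constancy

Helper file for the informal kernel crux `QuadrupoleSelectionRule` (stmt-CriticalPhenomena-7029) of
route `CardyFlipRusso` (sub-problem `CardyFormulaZ2`), line `Sketch`, generation 4 (lead c2).
The Poisson-leg counterpart of the bits-leg reduction `bits_of_pairRate_armBudget` (…BitsReduction):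
along a superposition leg `t ↦ P δ ⊗ Poisson(t • ρ δ)` the annealed Russo derivative is the
integral over `x` of the INSERTION RESPONSE `r_δ,t(x)` (landed Margulis–Russo formula and transfer,
`uniform_close_poissonLeg_of_kernel_bound`).  The inserted point is its own unit and its
modification law is rotation-symmetric about `x`, so — unlike the flip of a face — no pairing is
needed: the normalisation-free kernel is a POINT RATE (`|r(x)| ≤ C (δ/d(x))^θ · w(x)` beyond the
boundary layer `d(x) > C₀ δ`, `w ≥ |r|` the insertion arm weight) together with a POINT BUDGET
(`∫ cutoff · w dρ δ ≤ η δ → 0`), and the reduction is a one-line integral estimate.  Everything is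
stated over the hypotheses of the landed transfer theorem (def-free; the cut-off factor is the bits
leg's `BitsLeg.cutoff`, with `BitsLeg.cutoff_nonneg` from …BitsReduction).
-/

noncomputable section

open MeasureTheory Filter Topology Set
open scoped BigOperators

namespace Summit.CriticalPhenomena.CardyFormulaZ2.Theorems

open Literature.Analysis.FunctionSpaces
open Summit.CriticalPhenomena.CardyFormulaZ2.Theorems.BitsLeg (cutoff cutoff_nonneg)

section PoissonLeg

variable {E : Type*} [TopologicalSpace E] [T2Space E] [SecondCountableTopology E]
  [MeasurableSpace E] [BorelSpace E]

/-- **Point bound with cut-off.**  If a response `r` is dominated by a weight `w ≥ |r|`, and beyond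
the layer `d > C₀ δ` by `C (δ/d)^θ w`, then everywhere `|r| ≤ max 1 (C C₀^{-θ}) · cutoff · w`. -/
theorem abs_le_cutoff_mul_of_rate {r w d C₀ C θ δ : ℝ} (hC₀ : 0 < C₀) (hδ : 0 < δ)
    (hw : |r| ≤ w) (hrate : C₀ * δ < d → |r| ≤ C * (δ / d) ^ θ * w) :
    |r| ≤ max 1 (C * C₀⁻¹ ^ θ) * cutoff C₀ θ δ d * w := by
  have hw0 : 0 ≤ w := le_trans (abs_nonneg _) hw
  by_cases h : d ≤ C₀ * δ
  · have hcut : cutoff C₀ θ δ d = 1 := by simp [cutoff, h]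
    rw [hcut, mul_one]
    calc |r| ≤ w := hw
      _ = 1 * w := (one_mul _).symm
      _ ≤ max 1 (C * C₀⁻¹ ^ θ) * w := mul_le_mul_of_nonneg_right (le_max_left _ _) hw0
  · push Not at h
    have hd : 0 < d := lt_trans (mul_pos hC₀ hδ) h
    have hcut : cutoff C₀ θ δ d = (C₀ * δ / d) ^ θ := by simp [cutoff, not_le.2 h]
    have hsplit : (δ / d) ^ θ = C₀⁻¹ ^ θ * (C₀ * δ / d) ^ θ := by
      rw [← Real.mul_rpow (inv_nonneg.2 hC₀.le) (div_nonneg (mul_pos hC₀ hδ).le hd.le)]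
      congr 1
      field_simp
    calc |r| ≤ C * (δ / d) ^ θ * w := hrate h
      _ = (C * C₀⁻¹ ^ θ) * cutoff C₀ θ δ d * w := by rw [hcut, hsplit]; ring
      _ ≤ max 1 (C * C₀⁻¹ ^ θ) * cutoff C₀ θ δ d * w := by
          apply mul_le_mul_of_nonneg_right _ hw0
          exact mul_le_mul_of_nonneg_right (le_max_right _ _) (cutoff_nonneg C₀ θ δ _ hC₀ hδ)

/-- **Point rate + point budget ⟹ kernel bound.**  For a response `x ↦ r x` dominated by weights
`w`, with the rate beyond the layer and an integrable cut-off-weighted budget `≤ B`, the integrated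
response is at most `max 1 (C C₀^{-θ}) · B` in absolute value. -/
theorem abs_integral_le_of_pointRate :
    ∀ (X : Type*) [MeasurableSpace X] (μ : MeasureTheory.Measure X) (r w d : X → ℝ) (C₀ C θ δ B : ℝ),
      0 < C₀ → 0 < δ → (∀ x, |r x| ≤ w x) → (∀ x, C₀ * δ < d x → |r x| ≤ C * (δ / d x) ^ θ * w x) →
        MeasureTheory.Integrable
            (fun x => Summit.CriticalPhenomena.CardyFormulaZ2.Theorems.BitsLeg.cutoff C₀ θ δ (d x) * w x) μ →
          ∫ x, Summit.CriticalPhenomena.CardyFormulaZ2.Theorems.BitsLeg.cutoff C₀ θ δ (d x) * w x ∂μ ≤ B →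
            |∫ x, r x ∂μ| ≤ max 1 (C * C₀⁻¹ ^ θ) * B := by
  intro X _ μ r w d C₀ C θ δ B hC₀ hδ hw hrate hint hbudget
  set K : ℝ := max 1 (C * C₀⁻¹ ^ θ) with hK
  have hK0 : 0 ≤ K := le_trans zero_le_one (le_max_left _ _)
  have hpt : ∀ x, |r x| ≤ K * (cutoff C₀ θ δ (d x) * w x) := fun x => by
    rw [← mul_assoc]; exact abs_le_cutoff_mul_of_rate hC₀ hδ (hw x) (hrate x)
  calc |∫ x, r x ∂μ| ≤ ∫ x, |r x| ∂μ := abs_integral_le_integral_abs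
    _ ≤ ∫ x, K * (cutoff C₀ θ δ (d x) * w x) ∂μ :=
        integral_mono_of_nonneg (Eventually.of_forall fun x => abs_nonneg _) (hint.const_mul K)
          (Eventually.of_forall hpt)
    _ = K * ∫ x, cutoff C₀ θ δ (d x) * w x ∂μ := integral_const_mul _ _
    _ ≤ K * B := mul_le_mul_of_nonneg_left hbudget hK0

/-- **Point rate + point budget ⟹ leg constancy (Poisson superposition leg).**  In the setting of
`uniform_close_poissonLeg_of_kernel_bound` (rest laws `P δ`, atomless finite `ρ δ`, Poisson
`Q δ t` of intensity `t • ρ δ`, bounded measurable `F δ`), suppose the insertion response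
`r_δ,t(x) = ∫ F δ (c ∪ c' ∪ {x}) − ∫ F δ (c ∪ c')` is dominated by weights `w δ t x`, obeys the POINT
RATE `|r| ≤ C (δ/d δ x)^θ · w` beyond the layer `d δ x > C₀ δ`, and the cut-off-weighted weights have
an integrable POINT BUDGET `≤ η δ → 0` uniformly in `t ∈ [0, 1)`.  Then the annealed observable is
uniformly close along the whole leg for small mesh. -/
theorem uniform_close_poissonLeg_of_pointRate
    (P : ℝ → Measure (PointConfig E)) [∀ δ, IsFiniteMeasure (P δ)]
    (ρ : ℝ → Measure E) [∀ δ, IsFiniteMeasure (ρ δ)] (hρ : ∀ δ x, ρ δ {x} = 0)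
    (Q : ℝ → ℝ → Measure (PointConfig E))
    (hQ : ∀ δ t, 0 ≤ t → IsPoissonPointProcess ((ENNReal.ofReal t) • ρ δ) (Q δ t))
    (F : ℝ → PointConfig E → ℝ) (hFm : ∀ δ, Measurable (F δ)) (M : ℝ → ℝ)
    (hFb : ∀ δ c, |F δ c| ≤ M δ)
    (w : ℝ → ℝ → E → ℝ) (d : ℝ → E → ℝ) (C₀ C θ : ℝ) (hC₀ : 0 < C₀)
    (hw : ∀ δ, 0 < δ → δ < 1 → ∀ t ∈ Ico (0 : ℝ) 1, ∀ x,
      |(∫ p, F δ (p.1 ∪ p.2 ∪ PointConfig.ofFn ![x]) ∂((P δ).prod (Q δ t))) -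
          ∫ p, F δ (p.1 ∪ p.2) ∂((P δ).prod (Q δ t))| ≤ w δ t x)
    (hrate : ∀ δ, 0 < δ → δ < 1 → ∀ t ∈ Ico (0 : ℝ) 1, ∀ x, C₀ * δ < d δ x →
      |(∫ p, F δ (p.1 ∪ p.2 ∪ PointConfig.ofFn ![x]) ∂((P δ).prod (Q δ t))) -
          ∫ p, F δ (p.1 ∪ p.2) ∂((P δ).prod (Q δ t))| ≤ C * (δ / d δ x) ^ θ * w δ t x)
    (hint : ∀ δ, 0 < δ → δ < 1 → ∀ t ∈ Ico (0 : ℝ) 1,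
      Integrable (fun x => cutoff C₀ θ δ (d δ x) * w δ t x) (ρ δ))
    (η : ℝ → ℝ)
    (hbudget : ∀ δ, 0 < δ → δ < 1 → ∀ t ∈ Ico (0 : ℝ) 1,
      ∫ x, cutoff C₀ θ δ (d δ x) * w δ t x ∂(ρ δ) ≤ η δ)
    (hη : Tendsto η (𝓝[>] 0) (𝓝 0)) :
    ∀ ε : ℝ, 0 < ε → ∃ δ₀ : ℝ, 0 < δ₀ ∧ ∀ δ : ℝ, 0 < δ → δ < δ₀ →
      ∀ t ∈ Icc (0 : ℝ) 1, ∀ t' ∈ Icc (0 : ℝ) 1,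
        |(∫ p, F δ (p.1 ∪ p.2) ∂((P δ).prod (Q δ t))) -
          ∫ p, F δ (p.1 ∪ p.2) ∂((P δ).prod (Q δ t'))| ≤ ε := by
  set K : ℝ := max 1 (C * C₀⁻¹ ^ θ) with hK
  refine uniform_close_poissonLeg_of_kernel_bound P ρ hρ Q hQ F hFm M hFb (fun δ => K * η δ)
    (fun δ hδ hδ1 t ht => ?_) (by simpa using hη.const_mul K)
  exact abs_integral_le_of_pointRate E (ρ δ) _ (w δ t) (d δ) C₀ C θ δ (η δ) hC₀ hδ
    (hw δ hδ hδ1 t ht) (hrate δ hδ hδ1 t ht) (hint δ hδ hδ1 t ht) (hbudget δ hδ hδ1 t ht)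

end PoissonLeg

end Summit.CriticalPhenomena.CardyFormulaZ2.Theorems

end
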